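import Mathlib
import Summits.MatrixMultiplication.MatrixMultiplication.Theses.SnSubsetDichotomy
import Summits.MatrixMultiplication.MatrixMultiplication.Theorems.SnSubsetDichotomyNoThresholdSubsetTripleDefs
import Summits.MatrixMultiplication.MatrixMultiplication.Theorems.SnSubsetDichotomyNoThresholdSubsetTripleStubHdCount
import Summits.MatrixMultiplication.MatrixMultiplication.Theorems.SnSubsetDichotomyNoThresholdSubsetTripleStubSpreadTransfer

/-!
# Skeleton line `sidon-regime-hereditary-density` for crux `NoThresholdSubsetTriple`
(stmt-MatrixMultiplication-8302) — lead's reshaped skeleton, v3 (2026-08-16)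

Route `SnSubsetDichotomy`, crux (rank 0, the route's NEGATIVE SIDE `¬ThresholdSubsetTriples`)
`NoThresholdSubsetTriple =
  ∃ c > 0, ∃ n₀, ∀ n ≥ n₀, ∀ S T U ⊆ S_n with the TPP, |S||T||U| ≤ (n!)^{3/2} · e^{-c√n}`
(BCCGU17 arXiv:1712.02302 §6's negative-direction target for SUBSETS; open problem).

v3 (lead prover-line-stmt-MatrixMultiplication-8302-0): the vocabulary (`diffSet`, `overlap`,
`selfOverlap`, `Spreadable`, the statements `HDCount`, `NoHDProductFreeTriple`, the first lemma
`diffSets_of_tpp`) now lives in the LANDED file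
`Theorems/SnSubsetDichotomyNoThresholdSubsetTripleDefs.lean` (p92506), and two stubs are LANDED:
`stub_hdCount` (p93834, `…StubHdCount.lean`) and `stub_spreadTransfer` (p93801,
`…StubSpreadTransfer.lean`). Open: `stub_noHDProductFreeTriple` (C⁺_HD, the line's target) and
`stub_nonSpreadBranch` (the structured regime; hand-off node). The composition
`NoThresholdSubsetTriple_of` uses the four stubs directly (no hypotheses), so the file audit reads
"proof-of-item, NOT closed: sorryAx" until the two open stubs land.

## The line (idea card `sidon-regime-hereditary-density`; planner's skeleton v1, triage r1 ×3 pass)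
TPP ⟹ the three difference sets D_X = X·X⁻¹ ∖ {1} are pairwise disjoint and the ORDERED triple is
product-free (`diffSets_of_tpp`, proved); a K'-spreadable set (large core X₀ with translate
self-overlap m(X₀) ≤ e^{K'√n}) of threshold size has, by the hereditary-density count
(`stub_hdCount`: |X|² ≤ [G:H](|X| + m(X)|D_X ∩ H|)), a difference set that is e^{-O(√n)}-dense in
EVERY subgroup of order ≥ √(n!)e^{O(√n)}; C⁺_HD (`stub_noHDProductFreeTriple`) says three such
symmetric disjoint HD sets always contain d₁d₂d₃ = 1; `stub_spreadTransfer` turns this into "no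
spreadable TPP triple beats any e^{-c√n}"; `stub_nonSpreadBranch` is the complementary (structured)
regime. Case split on "all three sets K'-spreadable".

## Disproof used (cdisprove v1–v8, through the item's evidence notes; the file is not mounted here)
`false_without_TPP` — TPP consumed at `diffSets_of_tpp`; `holds_without_posConst` — every stub keeps
c > 0, packing only sizes the cores; `false_without_n0` — all eventual; `false_with_pairwise_only` —
product-freeness of the ORDERED triple is the genuine 3-fold condition; `crux_holds_for_young_triples`,
`hyperoctahedralSubsets_of_crux`, `polynomialSlack_of_crux` — those configurations are non-spread and
sit in `stub_nonSpreadBranch`.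
-/

set_option linter.dupNamespace false

noncomputable section

open scoped Classical
open Finset
open Literature.Combinatorics.Additive
open Summit.MatrixMultiplication.MatrixMultiplication.Theses.SnSubsetDichotomy
open Summit.MatrixMultiplication.MatrixMultiplication.Theorems.NoThresholdSubsetTriple

namespace Summit.MatrixMultiplication.MatrixMultiplication.Cruxes.NoThresholdSubsetTriple.SidonRegimeHereditaryDensity

/-! ### The registered stubs -/

/-- STUB 1 (M) — HEREDITARY-DENSITY COUNT in any finite group:
`|X|² ≤ [G:H] · (|X| + m(X) · |D_X ∩ H|)`. LANDED (p93834). -/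
theorem stub_hdCount :
    ∀ (G : Type) [Group G] [Fintype G] [DecidableEq G] (H : Subgroup G) (X : Finset G),
      X.card ^ 2 ≤ H.index * (X.card + selfOverlap X * ((diffSet X).filter (· ∈ H)).card) :=
  Summit.MatrixMultiplication.MatrixMultiplication.Theorems.NoThresholdSubsetTriple.stub_hdCount

/-- STUB 2 (L) — THE TRANSFER (Sidon-ification): `HDCount → C⁺_HD →` for all `K' > 0`, `c > 0`
there is `n₀` beyond which no TPP triple with three `K'`-spreadable sets has
`|S||T||U| > (n!)^{3/2}e^{-c√n}`. LANDED (p93801). -/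
theorem stub_spreadTransfer :
    HDCount → NoHDProductFreeTriple → ∀ K' : ℝ, 0 < K' → ∀ c : ℝ, 0 < c → ∃ n₀ : ℕ, ∀ n ≥ n₀,
      ∀ S T U : Finset (Equiv.Perm (Fin n)), TripleProductProperty S T U →
        Spreadable K' n S → Spreadable K' n T → Spreadable K' n U →
          ((S.card * T.card * U.card : ℕ) : ℝ) ≤
            (n.factorial : ℝ) ^ ((3 : ℝ) / 2) * Real.exp (-(c * Real.sqrt (n : ℝ))) :=
  Summit.MatrixMultiplication.MatrixMultiplication.Theorems.NoThresholdSubsetTriple.stub_spreadTransfer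

/-- STUB 3 (XL, OPEN — the line's TARGET and load-bearing bet) — `C⁺_HD`, NO HEREDITARILY DENSE
PRODUCT-FREE TRIPLE: for `K > 0` and `n ≥ n₀(K)`, symmetric pairwise-disjoint
`D₀, D₁, D₂ ⊆ S_n ∖ 1` with `|Dᵢ ∩ H| ≥ e^{-K√n}|H|` for every subgroup `|H| ≥ √(n!)e^{K√n}`
contain `d₀d₁d₂ = 1`. See the planner's skeleton v1 docstring for "why plausible / why it might
fail" (it is in substance an inverse theorem for tricoloured product-free triples at density
`e^{-Θ(√n)}`, below every published engine; HD does not exclude level-1 diagonal structure). -/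
theorem stub_noHDProductFreeTriple :
    ∀ K : ℝ, 0 < K → ∃ n₀ : ℕ, ∀ n ≥ n₀, ∀ D : Fin 3 → Finset (Equiv.Perm (Fin n)),
      (∀ i, ∀ d ∈ D i, d⁻¹ ∈ D i) → (∀ i, (1 : Equiv.Perm (Fin n)) ∉ D i) →
        (∀ i j, i ≠ j → Disjoint (D i) (D j)) →
          (∀ i, ∀ H : Subgroup (Equiv.Perm (Fin n)),
              Real.sqrt (n.factorial : ℝ) * Real.exp (K * Real.sqrt (n : ℝ)) ≤ (Nat.card H : ℝ) →
                Real.exp (-(K * Real.sqrt (n : ℝ))) * (Nat.card H : ℝ) ≤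
                  (((D i).filter (· ∈ H)).card : ℝ)) →
            ∃ d₁ ∈ D 0, ∃ d₂ ∈ D 1, ∃ d₃ ∈ D 2, d₁ * d₂ * d₃ = 1 := by
  sorry

/-- STUB 4 (XL⁺, OPEN, HARDEST — the complementary regime; hand-off node) — THE NON-SPREAD
(STRUCTURED) BRANCH: for some `K' > 0` and `c > 0`, every TPP triple in `S_n` (`n ≥ n₀`) with a
robustly non-spread set satisfies `|S||T||U| ≤ (n!)^{3/2}e^{-c√n}`. Contains every near-threshold
configuration on record (subgroups of order ≈ √(n!), Young and hyperoctahedral triples, the route's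
open cruxes r4/r5). -/
theorem stub_nonSpreadBranch :
    ∃ K' : ℝ, 0 < K' ∧ ∃ c : ℝ, 0 < c ∧ ∃ n₀ : ℕ, ∀ n ≥ n₀,
      ∀ S T U : Finset (Equiv.Perm (Fin n)), TripleProductProperty S T U →
        (¬ Spreadable K' n S ∨ ¬ Spreadable K' n T ∨ ¬ Spreadable K' n U) →
          ((S.card * T.card * U.card : ℕ) : ℝ) ≤
            (n.factorial : ℝ) ^ ((3 : ℝ) / 2) * Real.exp (-(c * Real.sqrt (n : ℝ))) := by
  sorry

/-! ### The composition: the four stubs imply the crux, by name (no hypotheses) -/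

/-- `NoThresholdSubsetTriple` from the four stubs: take `K', c, n₄` from the non-spread branch
(STUB 4) and `n₂ = n₀(K', c)` from the transfer (STUB 2 fed with STUBS 1 and 3); for
`n ≥ max n₂ n₄` and a TPP triple, either all three sets are `K'`-spreadable (STUB 2) or one is not
(STUB 4); both give the bound with the SAME `c`. -/
theorem NoThresholdSubsetTriple_of :
    Summit.MatrixMultiplication.MatrixMultiplication.Theses.SnSubsetDichotomy.NoThresholdSubsetTriple := by
  obtain ⟨K', hK', c, hc, n₄, h4⟩ := stub_nonSpreadBranch
  obtain ⟨n₂, h2⟩ := stub_spreadTransfer stub_hdCount stub_noHDProductFreeTriple K' hK' c hc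
  refine ⟨c, hc, max n₂ n₄, fun n hn S T U hTPP => ?_⟩
  by_cases hsp : Spreadable K' n S ∧ Spreadable K' n T ∧ Spreadable K' n U
  · exact h2 n ((le_max_left n₂ n₄).trans hn) S T U hTPP hsp.1 hsp.2.1 hsp.2.2
  · exact h4 n ((le_max_right n₂ n₄).trans hn) S T U hTPP (by simpa only [not_and_or] using hsp)

end Summit.MatrixMultiplication.MatrixMultiplication.Cruxes.NoThresholdSubsetTriple.SidonRegimeHereditaryDensity

end
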